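import Literature.NumberTheory.LFunctions.Zhang2022.RepairCrossFormDictionary
import Literature.NumberTheory.LFunctions.Zhang2022.RepairTentForm

/-!
# K-S3 faithfulness, `H₂`-blocks (pieces): formula I of one `ϰ`-component against the reflected tent `J₂`

Trunk T-ANT (NumberTheory/LFunctions). Repair rung F-S1R (D-0077) for Y. Zhang, *Discrete mean estimates and
the Landau–Siegel zero*, arXiv:2211.02515v1 [Zhang2022LandauSiegel] — **an unrefereed manuscript under
adjudication; nothing here asserts any of its claims.** Companion of `RepairCrossFormDictionary` (`dSum2S θ =
M(f₂,g₂) + conj M(g₂,f₂)`, `f₂ = tentT θ.reflectJ` the tent of `J₂ = [1−ν₁, 1−ν₂]`, `g₂ = ῑ₄ϰ_{ν₂,k₂} + ῑ₃ϰ_{ν₃,k₃}`)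
and of `RepairSection10Theta` (`d5pT, d5T, d5xT, d6pT, d6T, d6cT, d6xT`): the four single-component integrals from
which the `𝔡′`-block is assembled by linearity (file `RepairCrossFormSection10H2`) —

* `integral_dip_rtent_kappa_full` — `M`-integrand of `(J₂, ϰ_{ν,k})` for a component COVERING `J₂` (`1−ν₂ ≤ ν`,
  the `H₁₂`-term when `ν₂ ≥ 1/2`): the two tent halves after `y = mid₂ − z`, `y = hi₂ − z` (arguments `e + h + z`,
  `e + z`, `e = ν − hi₂`; the `ι₄`-lines of the display before (10.14));
* `integral_dip_rtent_kappa_part` — the same for a component ENDING INSIDE `J₂` (`1−ν₁ < ν₃ < 1−ν₂`, the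
  `H₁₃`-term): lower half on `[1−ν₁, min(ν₃, mid₂)]` after `w = ν₃ − y` (window `[g₀, L₆]`, the `ι₃`-lines and
  `d′₅ⱼ`), upper half on `[mid₂, max(mid₂, ν₃)]` verbatim (`d5xT`, empty in print);
* `integral_dip_kappa_rtent_full`, `integral_dip_kappa_rtent_part` — the transposed blocks (`ϰ` on the `m`-side,
  the tent's tail functional `−σ(−1+𝔶𝔶₁ʳ)`, `−σ(1+𝔶𝔶₂ʳ)`, `π²N_jh`, `0` on the `n`-side): the lines of `d₆ⱼ`,
  `d′₆ⱼ`, `d6cT`, `d6xT`.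

Pure calculus; no new `Prop` facts, no statement about Theorems 1–2.
-/

noncomputable section

open Complex Real ComplexConjugate MeasureTheory Set intervalIntegral
open scoped Interval

namespace Literature.NumberTheory.LFunctions.Zhang2022

namespace Repair

variable {θ : Theta} {ν k : ℝ}

/-- continuity of the `𝔣𝔣`-profiles (local copy for `fun_prop`). [cite: Zhang2022LandauSiegel, (8.13)–(8.18)] -/
@[fun_prop] private theorem ffT_cont (k : ℝ) (j : ℕ) : Continuous (ffT k j) := by unfold ffT ffR; fun_prop
/-- continuity of the `𝔤𝔥`-profiles. [cite: Zhang2022LandauSiegel, (8.13)–(8.18)] -/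
@[fun_prop] private theorem ghT_cont (k : ℝ) (j : ℕ) : Continuous (ghT k j) := by unfold ghT ghR; fun_prop

/-- the tail functional of `ϰ_{ν,k}` vanishes on `[ν, 1]`. [cite: Zhang2022LandauSiegel, (2.23)–(2.25) p.9] -/
theorem kappa_tail_of_ge (hν : 0 < ν) (j : ℕ) {y : ℝ} (hy : ν ≤ y) (hy1 : y ≤ 1) :
    conj (kappaP' ν k y + I * π * ((bS j : ℝ) : ℂ) * kappaP ν k y
        + (π : ℂ) ^ 2 * ((bN j : ℝ) : ℂ) * ∫ t in y..1, kappaP ν k t) = 0 := by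
  rw [kappaP'_of_ge hy, kappaP_of_ge hν.ne' hy, integral_kappaP_tail_of_ge hν hy hy1]; simp

/-- the `m`-side of `ϰ_{ν,k}` vanishes on `[ν, ∞)`. [cite: Zhang2022LandauSiegel, (2.23)–(2.25) p.9] -/
theorem kappa_mside_of_ge (hν : ν ≠ 0) (j : ℕ) {y : ℝ} (hy : ν ≤ y) :
    kappaP' ν k y + I * π * (j : ℂ) * kappaP ν k y = 0 := by
  rw [kappaP'_of_ge hy, kappaP_of_ge hν hy]; simp

/-- `mid₂ = (1 − ν₁) + h` and `1 − ν₂ = mid₂ + h`. [cite: Zhang2022LandauSiegel, (2.30) p.10] -/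
theorem Theta.mid2_eq (θ : Theta) : θ.mid2 = (1 - θ.nu1) + θ.hw ∧ 1 - θ.nu2 = θ.mid2 + θ.hw := by
  unfold Theta.mid2 Theta.mid1 Theta.hw; constructor <;> ring

/-! ### `(J₂, ϰ)` with the component covering `J₂` -/

/-- **formula I on `(J₂, ϰ_{ν,k})`, full coverage** (`1 − ν₂ ≤ ν ≤ 1`): with `e = ν − (1−ν₂)`,
`∫₀¹ (f₂′+iπjf₂)·conj(ϰ′+iπS_jϰ+π²N_j∫ϰ) = (σ/ν)(−∫₀^h𝔤𝔥(e+h+z) − iπj∫₀^h(h−z)𝔤𝔥(e+h+z) + ∫₀^h𝔤𝔥(e+z) − iπj∫₀^h z𝔤𝔥(e+z))`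
(the `ι₄`-lines of the display before (10.14)). [cite: Zhang2022LandauSiegel, §10 before (10.14) p.56] -/
theorem integral_dip_rtent_kappa_full (h21 : θ.nu2 < θ.nu1) (h1 : θ.nu1 ≤ 1) (hν : 0 < ν)
    (hνhi : 1 - θ.nu2 ≤ ν) (hν1 : ν ≤ 1) (hk : k ≠ 0) (j : ℕ) :
    ∫ y in (0:ℝ)..1, dipoleIntegrand j (tentT θ.reflectJ) (tentT' θ.reflectJ) (kappaP ν k) (kappaP' ν k) y
      = (((1 / ν : ℝ)) : ℂ) * (θ.sig : ℂ) *
          (-(∫ z in (0:ℝ)..θ.hw, ghT k j (ν - (1 - θ.nu2) + θ.hw + z))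
            - I * π * (j : ℂ) * (∫ z in (0:ℝ)..θ.hw, (((θ.hw - z : ℝ)) : ℂ) * ghT k j (ν - (1 - θ.nu2) + θ.hw + z))
            + (∫ z in (0:ℝ)..θ.hw, ghT k j (ν - (1 - θ.nu2) + z))
            - I * π * (j : ℂ) * ∫ z in (0:ℝ)..θ.hw, (z : ℂ) * ghT k j (ν - (1 - θ.nu2) + z)) := by
  have hr := reflectJ_lt h21
  obtain ⟨hml, hmh⟩ := θ.mid2_eq
  have hp := θ.hw_pos h21
  have hlo : 0 ≤ 1 - θ.nu1 := by linarith
  have hkf := kinkedProfile_tentT hr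
  have hkk := kinkedProfile_kappaP (k := k) hν hν1
  have hI := intervalIntegrable_dipoleIntegrand hkf hkk j
  have hsub : ∀ {a b : ℝ}, 0 ≤ a → a ≤ b → b ≤ 1 → IntervalIntegrable
      (dipoleIntegrand j (tentT θ.reflectJ) (tentT' θ.reflectJ) (kappaP ν k) (kappaP' ν k)) volume a b :=
    fun ha hab hb => hI.mono_set (by rw [uIcc_of_le zero_le_one, uIcc_of_le hab]; exact Icc_subset_Icc ha hb)
  -- below `J₂`
  have e0 : ∫ y in (0:ℝ)..(1 - θ.nu1),
      dipoleIntegrand j (tentT θ.reflectJ) (tentT' θ.reflectJ) (kappaP ν k) (kappaP' ν k) y = 0 := by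
    rw [intervalIntegral.integral_congr_uIoo (g := fun _ => (0:ℂ)) fun y hy => ?_, intervalIntegral.integral_zero]
    rw [uIoo_of_le hlo] at hy
    unfold dipoleIntegrand
    rw [tentT'_of_lt_lo (θ := θ.reflectJ) (by simpa using hy.2),
      tentT_of_le_lo (θ := θ.reflectJ) hr (by simpa using hy.2.le)]; ring
  -- lower half of `J₂`: `y = mid₂ − z`
  set gL : ℝ → ℂ := fun z => ghT k j (ν - (1 - θ.nu2) + θ.hw + z)
      + I * π * (j : ℂ) * ((((θ.hw - z : ℝ)) : ℂ) * ghT k j (ν - (1 - θ.nu2) + θ.hw + z)) with hgL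
  have e1 : ∫ y in (1 - θ.nu1)..θ.mid2,
      dipoleIntegrand j (tentT θ.reflectJ) (tentT' θ.reflectJ) (kappaP ν k) (kappaP' ν k) y
      = -((((1 / ν : ℝ)) : ℂ) * (θ.sig : ℂ)) * ∫ z in (0:ℝ)..θ.hw, gL z := by
    have hc : ∫ y in (1 - θ.nu1)..θ.mid2, gL (θ.mid2 - y) = ∫ z in (0:ℝ)..θ.hw, gL z := by
      have := intervalIntegral.integral_comp_sub_left gL θ.mid2 (a := 1 - θ.nu1) (b := θ.mid2)
      rw [sub_self, show θ.mid2 - (1 - θ.nu1) = θ.hw by rw [hml]; ring] at this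
      exact this
    rw [← hc, ← intervalIntegral.integral_const_mul]
    refine intervalIntegral.integral_congr_uIoo fun y hy => ?_
    rw [uIoo_of_le (by linarith)] at hy
    unfold dipoleIntegrand
    rw [tentDipole_lower (θ := θ.reflectJ) (by simp; linarith [hy.1]) (by rw [reflectJ_mid1]; exact hy.2),
      conj_kappa_gside_eq_ghT hk hν hν1 j (by linarith [hy.2]), hgL]
    simp only [reflectJ_sig, reflectJ_nu2]
    rw [show ν - (1 - θ.nu2) + θ.hw + (θ.mid2 - y) = ν - y by rw [hmh]; ring,
      show ((θ.hw - (θ.mid2 - y) : ℝ) : ℂ) = (y : ℂ) - ((1 - θ.nu1 : ℝ) : ℂ) by rw [hml]; push_cast; ring]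
    ring
  -- upper half of `J₂`: `y = hi₂ − z`
  set gU : ℝ → ℂ := fun z => ghT k j (ν - (1 - θ.nu2) + z)
      - I * π * (j : ℂ) * ((z : ℂ) * ghT k j (ν - (1 - θ.nu2) + z)) with hgU
  have e2 : ∫ y in θ.mid2..(1 - θ.nu2),
      dipoleIntegrand j (tentT θ.reflectJ) (tentT' θ.reflectJ) (kappaP ν k) (kappaP' ν k) y
      = ((((1 / ν : ℝ)) : ℂ) * (θ.sig : ℂ)) * ∫ z in (0:ℝ)..θ.hw, gU z := by
    have hc : ∫ y in θ.mid2..(1 - θ.nu2), gU ((1 - θ.nu2) - y) = ∫ z in (0:ℝ)..θ.hw, gU z := by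
      have := intervalIntegral.integral_comp_sub_left gU (1 - θ.nu2) (a := θ.mid2) (b := 1 - θ.nu2)
      rw [sub_self, show (1 - θ.nu2) - θ.mid2 = θ.hw by rw [hmh]; ring] at this
      exact this
    rw [← hc, ← intervalIntegral.integral_const_mul]
    refine intervalIntegral.integral_congr_uIoo fun y hy => ?_
    rw [uIoo_of_le (by linarith)] at hy
    unfold dipoleIntegrand
    rw [tentDipole_upper (θ := θ.reflectJ) hr (by rw [reflectJ_mid1]; exact hy.1.le) (by simpa using hy.2),
      conj_kappa_gside_eq_ghT hk hν hν1 j (by linarith [hy.2]), hgU]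
    simp only [reflectJ_sig, reflectJ_nu1]
    rw [show ν - (1 - θ.nu2) + ((1 - θ.nu2) - y) = ν - y by ring]
    push_cast
    ring
  -- above `J₂`
  have e3 : ∫ y in (1 - θ.nu2)..1,
      dipoleIntegrand j (tentT θ.reflectJ) (tentT' θ.reflectJ) (kappaP ν k) (kappaP' ν k) y = 0 := by
    rw [intervalIntegral.integral_congr_uIoo (g := fun _ => (0:ℂ)) fun y hy => ?_, intervalIntegral.integral_zero]
    rw [uIoo_of_le (by linarith)] at hy
    unfold dipoleIntegrand
    rw [tentT'_of_hi_le (θ := θ.reflectJ) hr (by simpa using hy.1.le),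
      tentT_of_hi_le (θ := θ.reflectJ) hr (by simpa using hy.1.le)]; ring
  have iGa : IntervalIntegrable (fun z => ghT k j (ν - (1 - θ.nu2) + θ.hw + z)) volume 0 θ.hw :=
    Continuous.intervalIntegrable (by fun_prop) _ _
  have iGb : IntervalIntegrable (fun z => (((θ.hw - z : ℝ)) : ℂ) * ghT k j (ν - (1 - θ.nu2) + θ.hw + z))
      volume 0 θ.hw := Continuous.intervalIntegrable (by fun_prop) _ _
  have iGc : IntervalIntegrable (fun z => ghT k j (ν - (1 - θ.nu2) + z)) volume 0 θ.hw :=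
    Continuous.intervalIntegrable (by fun_prop) _ _
  have iGd : IntervalIntegrable (fun z => (z : ℂ) * ghT k j (ν - (1 - θ.nu2) + z)) volume 0 θ.hw :=
    Continuous.intervalIntegrable (by fun_prop) _ _
  have gl : (∫ z in (0:ℝ)..θ.hw, gL z) = (∫ z in (0:ℝ)..θ.hw, ghT k j (ν - (1 - θ.nu2) + θ.hw + z))
      + I * π * (j : ℂ) * ∫ z in (0:ℝ)..θ.hw, (((θ.hw - z : ℝ)) : ℂ) * ghT k j (ν - (1 - θ.nu2) + θ.hw + z) := by
    rw [hgL, intervalIntegral.integral_add iGa (iGb.const_mul _), intervalIntegral.integral_const_mul]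
  have gu : (∫ z in (0:ℝ)..θ.hw, gU z) = (∫ z in (0:ℝ)..θ.hw, ghT k j (ν - (1 - θ.nu2) + z))
      - I * π * (j : ℂ) * ∫ z in (0:ℝ)..θ.hw, (z : ℂ) * ghT k j (ν - (1 - θ.nu2) + z) := by
    rw [hgU, intervalIntegral.integral_sub iGc (iGd.const_mul _), intervalIntegral.integral_const_mul]
  have t1 := intervalIntegral.integral_add_adjacent_intervals
    (hsub (a := 0) (b := 1 - θ.nu1) le_rfl hlo (by linarith))
    (hsub (a := 1 - θ.nu1) (b := 1) hlo (by linarith) le_rfl)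
  have t2 := intervalIntegral.integral_add_adjacent_intervals
    (hsub (a := 1 - θ.nu1) (b := θ.mid2) hlo (by linarith) (by linarith))
    (hsub (a := θ.mid2) (b := 1) (by linarith) (by linarith) le_rfl)
  have t3 := intervalIntegral.integral_add_adjacent_intervals
    (hsub (a := θ.mid2) (b := 1 - θ.nu2) (by linarith) (by linarith) (by linarith))
    (hsub (a := 1 - θ.nu2) (b := 1) (by linarith) (by linarith) le_rfl)
  rw [← t1, ← t2, ← t3, e0, e1, e2, e3, gl, gu]
  ring

/-! ### `(J₂, ϰ₃)` with the component ending inside `J₂` -/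

/-- clip points of the `H₁₃`-window on `J₂` (for `1−ν₁ ≤ ν₃ ≤ 1−ν₂`): `ν₃ − min(ν₃, mid₂) = g₀`,
`ν₃ − (1−ν₁) = L₆`, `x₃ = max(mid₂, ν₃)`, `mid₂ − min(ν₃, mid₂) = min(h, max(0, mid₂ − ν₃))`.
[cite: Zhang2022LandauSiegel, §10 p.56] -/
theorem Theta.clip_eqs (h21 : θ.nu2 < θ.nu1) (h3lo : 1 - θ.nu1 ≤ θ.nu3) (h3hi : θ.nu3 ≤ 1 - θ.nu2) :
    θ.nu3 - min θ.nu3 θ.mid2 = θ.g0 ∧ θ.nu3 - (1 - θ.nu1) = θ.L6 ∧ θ.x3 = max θ.mid2 θ.nu3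
      ∧ θ.mid2 - min θ.nu3 θ.mid2 = min θ.hw (max 0 (θ.mid2 - θ.nu3)) := by
  obtain ⟨hml, hmh⟩ := θ.mid2_eq
  have hp := θ.hw_pos h21
  refine ⟨?_, by unfold Theta.L6; ring, by unfold Theta.x3 Theta.hi2; rw [min_eq_left h3hi], ?_⟩
  · unfold Theta.g0
    rcases le_total θ.nu3 θ.mid2 with h | h
    · rw [min_eq_left h, max_eq_left (by linarith)]; ring
    · rw [min_eq_right h, max_eq_right (by linarith)]
  · rcases le_total θ.nu3 θ.mid2 with h | h
    · rw [min_eq_left h, max_eq_right (by linarith), min_eq_right (by linarith)]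
    · rw [min_eq_right h, max_eq_left (by linarith), min_eq_right hp.le]; ring

/-- **formula I on `(J₂, ϰ_{ν₃,k₃})`, partial coverage** (`1−ν₁ < ν₃ ≤ 1−ν₂`):
`∫₀¹(f₂′+iπjf₂)·conj(tail ϰ₃) = −(σ/ν₃)(∫_{g₀}^{L₆}𝔤𝔥₃ + iπj∫_{g₀}^{L₆}(L₆−w)𝔤𝔥₃(w)dw) + (σ/ν₃)∫_{mid₂}^{max(mid₂,ν₃)}(1−iπj(hi₂−y))𝔤𝔥₃(ν₃−y)dy`
(`d′₅ⱼ`, the `ι₃`-line of `d₅ⱼ`, and `d5xT`). [cite: Zhang2022LandauSiegel, §10 before (10.14) p.56] -/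
theorem integral_dip_rtent_kappa_part (h2 : 0 ≤ θ.nu2) (h21 : θ.nu2 < θ.nu1) (h1 : θ.nu1 ≤ 1) (h3 : 0 < θ.nu3)
    (h3lo : 1 - θ.nu1 < θ.nu3) (h3hi : θ.nu3 ≤ 1 - θ.nu2) (h31 : θ.nu3 ≤ 1) (hk : θ.k3 ≠ 0) (j : ℕ) :
    ∫ y in (0:ℝ)..1, dipoleIntegrand j (tentT θ.reflectJ) (tentT' θ.reflectJ) (kappaP θ.nu3 θ.k3) (kappaP' θ.nu3 θ.k3) y
      = -((((1 / θ.nu3 : ℝ)) : ℂ) * (θ.sig : ℂ)) *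
            ((∫ w in θ.g0..θ.L6, ghT θ.k3 j w)
              + I * π * (j : ℂ) * ∫ w in θ.g0..θ.L6, (((θ.L6 - w : ℝ)) : ℂ) * ghT θ.k3 j w)
        + (((1 / θ.nu3 : ℝ)) : ℂ) * (θ.sig : ℂ) *
            ∫ y in θ.mid2..max θ.mid2 θ.nu3, (1 - (j : ℂ) * π * I * ((θ.hi2 : ℂ) - y)) * ghT θ.k3 j (θ.nu3 - y) := by
  have hr := reflectJ_lt h21
  obtain ⟨hml, hmh⟩ := θ.mid2_eq
  obtain ⟨cg0, cL6, -, -⟩ := θ.clip_eqs h21 h3lo.le h3hi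
  have hp := θ.hw_pos h21
  have hlo : 0 ≤ 1 - θ.nu1 := by linarith
  have hkf := kinkedProfile_tentT hr
  have hkk := kinkedProfile_kappaP (k := θ.k3) h3 h31
  have hI := intervalIntegrable_dipoleIntegrand hkf hkk j
  have hsub : ∀ {a b : ℝ}, 0 ≤ a → a ≤ b → b ≤ 1 → IntervalIntegrable
      (dipoleIntegrand j (tentT θ.reflectJ) (tentT' θ.reflectJ) (kappaP θ.nu3 θ.k3) (kappaP' θ.nu3 θ.k3))
        volume a b :=
    fun ha hab hb => hI.mono_set (by rw [uIcc_of_le zero_le_one, uIcc_of_le hab]; exact Icc_subset_Icc ha hb)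
  set m3 := min θ.nu3 θ.mid2 with hm3
  set x3 := max θ.mid2 θ.nu3 with hx3
  have hm3lo : 1 - θ.nu1 < m3 := lt_min h3lo (by linarith)
  have hm3mi : m3 ≤ θ.mid2 := min_le_right _ _
  have hx3mi : θ.mid2 ≤ x3 := le_max_left _ _
  have hx3hi : x3 ≤ 1 - θ.nu2 := max_le (by linarith) h3hi
  -- below `J₂`
  have e0 : ∫ y in (0:ℝ)..(1 - θ.nu1), dipoleIntegrand j (tentT θ.reflectJ) (tentT' θ.reflectJ)
      (kappaP θ.nu3 θ.k3) (kappaP' θ.nu3 θ.k3) y = 0 := by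
    rw [intervalIntegral.integral_congr_uIoo (g := fun _ => (0:ℂ)) fun y hy => ?_, intervalIntegral.integral_zero]
    rw [uIoo_of_le hlo] at hy
    unfold dipoleIntegrand
    rw [tentT'_of_lt_lo (θ := θ.reflectJ) (by simpa using hy.2),
      tentT_of_le_lo (θ := θ.reflectJ) hr (by simpa using hy.2.le)]; ring
  -- lower half, covered part `[lo₂, m3]`: `w = ν₃ − y`
  set gL : ℝ → ℂ := fun w => ghT θ.k3 j w + I * π * (j : ℂ) * ((((θ.L6 - w : ℝ)) : ℂ) * ghT θ.k3 j w) with hgL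
  have e1 : ∫ y in (1 - θ.nu1)..m3, dipoleIntegrand j (tentT θ.reflectJ) (tentT' θ.reflectJ)
      (kappaP θ.nu3 θ.k3) (kappaP' θ.nu3 θ.k3) y
      = -((((1 / θ.nu3 : ℝ)) : ℂ) * (θ.sig : ℂ)) * ∫ w in θ.g0..θ.L6, gL w := by
    have hc : ∫ y in (1 - θ.nu1)..m3, gL (θ.nu3 - y) = ∫ w in θ.g0..θ.L6, gL w := by
      have := intervalIntegral.integral_comp_sub_left gL θ.nu3 (a := 1 - θ.nu1) (b := m3)
      rw [cg0, cL6] at this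
      exact this
    rw [← hc, ← intervalIntegral.integral_const_mul]
    refine intervalIntegral.integral_congr_uIoo fun y hy => ?_
    rw [uIoo_of_le hm3lo.le] at hy
    have hy3 : y < θ.nu3 := lt_of_lt_of_le hy.2 (min_le_left _ _)
    unfold dipoleIntegrand
    rw [tentDipole_lower (θ := θ.reflectJ) (by simp; linarith [hy.1])
        (by rw [reflectJ_mid1]; exact lt_of_lt_of_le hy.2 hm3mi),
      conj_kappa_gside_eq_ghT hk h3 h31 j hy3, hgL]
    simp only [reflectJ_sig, reflectJ_nu2]
    rw [show ((θ.L6 - (θ.nu3 - y) : ℝ) : ℂ) = (y : ℂ) - ((1 - θ.nu1 : ℝ) : ℂ) by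
      rw [← cL6]; push_cast; ring]
    ring
  -- lower half, uncovered part `[m3, mid₂]`
  have e1' : ∫ y in m3..θ.mid2, dipoleIntegrand j (tentT θ.reflectJ) (tentT' θ.reflectJ)
      (kappaP θ.nu3 θ.k3) (kappaP' θ.nu3 θ.k3) y = 0 := by
    rw [intervalIntegral.integral_congr_uIoo (g := fun _ => (0:ℂ)) fun y hy => ?_, intervalIntegral.integral_zero]
    rw [uIoo_of_le hm3mi] at hy
    have hy3 : θ.nu3 ≤ y := by
      rcases min_lt_iff.1 hy.1 with h | h
      · exact h.le
      · exact absurd h (not_lt.2 hy.2.le)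
    unfold dipoleIntegrand
    rw [kappa_tail_of_ge h3 j hy3 (by linarith [hy.2])]; ring
  -- upper half, covered part `[mid₂, x3]` (verbatim)
  have e2 : ∫ y in θ.mid2..x3, dipoleIntegrand j (tentT θ.reflectJ) (tentT' θ.reflectJ)
      (kappaP θ.nu3 θ.k3) (kappaP' θ.nu3 θ.k3) y
      = (((1 / θ.nu3 : ℝ)) : ℂ) * (θ.sig : ℂ) *
          ∫ y in θ.mid2..x3, (1 - (j : ℂ) * π * I * ((θ.hi2 : ℂ) - y)) * ghT θ.k3 j (θ.nu3 - y) := by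
    rw [← intervalIntegral.integral_const_mul]
    refine intervalIntegral.integral_congr_uIoo fun y hy => ?_
    rw [uIoo_of_le hx3mi] at hy
    have hy3 : y < θ.nu3 := by
      rcases lt_max_iff.1 hy.2 with h | h
      · exact absurd h (not_lt.2 hy.1.le)
      · exact h
    unfold dipoleIntegrand
    rw [tentDipole_upper (θ := θ.reflectJ) hr (by rw [reflectJ_mid1]; exact hy.1.le)
        (by simp; linarith [hy.2]),
      conj_kappa_gside_eq_ghT hk h3 h31 j hy3]
    simp only [reflectJ_sig, reflectJ_nu1]
    unfold Theta.hi2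
    push_cast
    ring
  -- upper half, uncovered part `[x3, hi₂]`, and above `J₂`
  have e2' : ∫ y in x3..(1 - θ.nu2), dipoleIntegrand j (tentT θ.reflectJ) (tentT' θ.reflectJ)
      (kappaP θ.nu3 θ.k3) (kappaP' θ.nu3 θ.k3) y = 0 := by
    rw [intervalIntegral.integral_congr_uIoo (g := fun _ => (0:ℂ)) fun y hy => ?_, intervalIntegral.integral_zero]
    rw [uIoo_of_le hx3hi] at hy
    unfold dipoleIntegrand
    rw [kappa_tail_of_ge h3 j ((le_max_right _ _).trans hy.1.le) (by linarith [hy.2])]; ring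
  have e3 : ∫ y in (1 - θ.nu2)..1, dipoleIntegrand j (tentT θ.reflectJ) (tentT' θ.reflectJ)
      (kappaP θ.nu3 θ.k3) (kappaP' θ.nu3 θ.k3) y = 0 := by
    rw [intervalIntegral.integral_congr_uIoo (g := fun _ => (0:ℂ)) fun y hy => ?_, intervalIntegral.integral_zero]
    rw [uIoo_of_le (by linarith)] at hy
    unfold dipoleIntegrand
    rw [kappa_tail_of_ge h3 j (by linarith [hy.1]) hy.2.le]; ring
  have iGa : IntervalIntegrable (fun w => ghT θ.k3 j w) volume θ.g0 θ.L6 := Continuous.intervalIntegrable (by fun_prop) _ _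
  have iGb : IntervalIntegrable (fun w => (((θ.L6 - w : ℝ)) : ℂ) * ghT θ.k3 j w) volume θ.g0 θ.L6 :=
    Continuous.intervalIntegrable (by fun_prop) _ _
  have gl : (∫ w in θ.g0..θ.L6, gL w) = (∫ w in θ.g0..θ.L6, ghT θ.k3 j w)
      + I * π * (j : ℂ) * ∫ w in θ.g0..θ.L6, (((θ.L6 - w : ℝ)) : ℂ) * ghT θ.k3 j w := by
    rw [hgL, intervalIntegral.integral_add iGa (iGb.const_mul _), intervalIntegral.integral_const_mul]
  have t1 := intervalIntegral.integral_add_adjacent_intervals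
    (hsub (a := 0) (b := 1 - θ.nu1) le_rfl hlo (by linarith))
    (hsub (a := 1 - θ.nu1) (b := 1) hlo (by linarith) le_rfl)
  have t2 := intervalIntegral.integral_add_adjacent_intervals
    (hsub (a := 1 - θ.nu1) (b := m3) hlo hm3lo.le (by linarith))
    (hsub (a := m3) (b := 1) (by linarith) (by linarith) le_rfl)
  have t3 := intervalIntegral.integral_add_adjacent_intervals
    (hsub (a := m3) (b := θ.mid2) (by linarith) hm3mi (by linarith))
    (hsub (a := θ.mid2) (b := 1) (by linarith) (by linarith) le_rfl)
  have t4 := intervalIntegral.integral_add_adjacent_intervals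
    (hsub (a := θ.mid2) (b := x3) (by linarith) hx3mi (by linarith))
    (hsub (a := x3) (b := 1) (by linarith) (by linarith) le_rfl)
  have t5 := intervalIntegral.integral_add_adjacent_intervals
    (hsub (a := x3) (b := 1 - θ.nu2) (by linarith) hx3hi (by linarith))
    (hsub (a := 1 - θ.nu2) (b := 1) (by linarith) (by linarith) le_rfl)
  rw [← t1, ← t2, ← t3, ← t4, ← t5, e0, e1, e1', e2, e2', e3, gl]
  ring

end Repair

end Literature.NumberTheory.LFunctions.Zhang2022
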